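import Summits.CriticalPhenomena.SAWScalingLimit.Theses.SAWTotalPositivity
import Summits.CriticalPhenomena.SAWScalingLimit.Theorems.SAWLeftRightFKGTraversalBoundTight
import Literature.Probability.RandomPlanarGeometry.SAWSideProbability
import Literature.Probability.RandomPlanarGeometry.PolylineShellTraversals
import Literature.Probability.Percolation.BoxCrossingProofs

/-!
# `SAWTotalPositivity.SAWTraversalBound` (stmt-CriticalPhenomena-1880): one aspect ratio suffices

Support file for the statement item `SAWTraversalBound` as it appears in route `SAWTotalPositivity`
(the same text is the decl `SAWTraversalBound` of routes `SAWLeftRightFKG`, `SAWTargetMonotonicity`;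
the defs are definitionally equal, `sawTraversalBound_iff_leftRightFKG`). The item is the
Aizenman–Burchard multiple-traversal hypothesis (H1) (Duke Math. J. 99 (1999), (1.3)) for the law of
the critical square-lattice self-avoiding walk in a Dobrushin domain, with a SHELL-DEPENDENT
threshold `k x ρ R`.

What is certified here, on top of `SAWLeftRightFKGSAWTraversalBound.lean` /
`SAWLeftRightFKGTraversalBoundTight.lean` (items 1880 ⟺ 1881):

* `sawTraversalBound_of_aspectCountTight` — **ONE ASPECT RATIO, EVENTUALLY IN THE MESH, SUFFICES**:
  if for some `α > 1`, every Dobrushin domain / endpoint approximation, every shell `D(x; ρ, αρ)`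
  of aspect ratio exactly `α` (`0 < ρ`, `αρ ≤ 1`) and every `ε > 0` there is ONE threshold `k` with
  `P_δ(k separate traversals of D(x; ρ, αρ)) ≤ ε` for all sufficiently small meshes `δ` (a
  `𝓝[>] 0`-eventual statement — no mesh bookkeeping, no rate in `ρ`), then `SAWTraversalBound` holds
  (with `K = α³`, `λ = 3`, `δ₀ = 1`). Wide shells `R ≥ αρ` contain the aspect-`α` shell
  (`Curve.HasTraversals.mono'`) and take its `α³(ρ/R)³`-quantile as threshold; thin shells
  `R < αρ` are free because `α³ (ρ/R)³ > 1 ≥ P_δ` (`SAW.law_apply_le_one`); meshes above the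
  eventual range are handled by the deterministic short-distance count
  (`hasTraversals_toCurve_le`, `length_support_tail_le`: the event is empty).
* `aspectCountTight_of_eventualTight` — the converse from `EventualTight` (stmt-1881), for EVERY
  `α > 1` (`shellCountTight_of_eventualTight`).
* `sawTraversalBound_iff_aspectTwoCountTight` — hence, through the proved glue
  `TraversalBoundTight_proof`, the item is EQUIVALENT to eventual tightness of the traversal counts of
  the aspect-2 shells alone: this is the exact open core (precompactness of the critical planar SAW,
  Lawler–Schramm–Werner 2004 §3.4.2), stated with the fewest parameters.
* `sawTotalPositivity_sawTraversalBound_iff_eventualTight` — the certified equivalence 1880 ⟺ 1881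
  transported to this route's decl names.

No named fact is used; axioms are the standard three.
-/

noncomputable section

open MeasureTheory Filter Topology Set Metric
open Literature.Probability.RandomPlanarGeometry Literature.Probability.LatticeModels
open scoped ENNReal unitInterval

namespace Summit.CriticalPhenomena.SAWScalingLimit.Theorems

open Summit.CriticalPhenomena.SAWScalingLimit.Theses

/-! ### The decls of the three routes are the same proposition -/

/-- `SAWTotalPositivity.SAWTraversalBound` and `SAWLeftRightFKG.SAWTraversalBound` are the same
proposition (identical def bodies). [folklore] -/
theorem sawTraversalBound_iff_leftRightFKG :
    SAWTotalPositivity.SAWTraversalBound ↔ SAWLeftRightFKG.SAWTraversalBound :=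
  Iff.rfl

/-- `SAWTotalPositivity.EventualTight` and `SAWLeftRightFKG.EventualTight` are the same proposition
(identical def bodies). [folklore] -/
theorem eventualTight_iff_leftRightFKG :
    SAWTotalPositivity.EventualTight ↔ SAWLeftRightFKG.EventualTight :=
  Iff.rfl

/-- **Items stmt-1880 and stmt-1881 are equivalent, in route `SAWTotalPositivity`'s names**:
`SAWTraversalBound ↔ EventualTight` (the certified `sawTraversalBound_iff_eventualTight` of
`SAWLeftRightFKGTraversalBoundTight.lean`, transported along the definitional equalities above).
[folklore] -/
theorem sawTotalPositivity_sawTraversalBound_iff_eventualTight :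
    SAWTotalPositivity.SAWTraversalBound ↔ SAWTotalPositivity.EventualTight :=
  sawTraversalBound_iff_eventualTight

/-! ### One aspect ratio, eventually in the mesh, suffices -/

/-- **One aspect ratio suffices.** Let `α > 1`. Suppose that for every Dobrushin domain, endpoint
approximation, centre `x`, inner radius `ρ > 0` with `αρ ≤ 1` and `ε > 0` there is a threshold `k`
such that, for all sufficiently small meshes `δ > 0`, the mesh polyline of the critical SAW has `k`
separate traversals of the shell `D(x; ρ, αρ)` with probability at most `ε`. Then
`SAWTraversalBound` holds, with `K = α³`, `λ = 3`, `δ₀ = 1` and a shell-dependent threshold.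
Proof: for a wide shell (`αρ ≤ R`) a traversal of `D(x; ρ, R)` is a traversal of `D(x; ρ, αρ)`
(`Curve.HasTraversals.mono'`); take the `α³(ρ/R)³`-quantile threshold `k₁` of the hypothesis below
its eventual mesh `δ₁`, and above `δ₁` the threshold `k₂ = 2(#box + 1) + 1` at which the event is
EMPTY (`hasTraversals_toCurve_le`, `length_support_tail_le`); for a thin shell (`R < αρ`) the bound
`α³(ρ/R)³ > 1` exceeds the total mass of the law. (Aizenman–Burchard 1999, (1.3), read with the
tree's free threshold.) [folklore] -/
theorem sawTraversalBound_of_aspectCountTight {α : ℝ} (hα : 1 < α)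
    (h : ∀ (D : DobrushinDomain) (a b : ℝ → Site 2), SAW.IsEndpointApprox D a b →
      ∀ (x : ℂ) (ρ : ℝ), 0 < ρ → α * ρ ≤ 1 → ∀ ε : ℝ≥0∞, 0 < ε →
        ∃ k : ℕ, ∀ᶠ δ in 𝓝[>] (0 : ℝ),
          SAW.law D.carrier δ (a δ) (b δ)
            {γ | (⟨γ.walk.toCurve (meshPoint δ)⟩ : Curve ℂ).HasTraversals k x ρ (α * ρ)} ≤ ε) :
    SAWTotalPositivity.SAWTraversalBound := by
  classical
  intro D a b hab
  have hα0 : 0 < α := one_pos.trans hα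
  obtain ⟨r, hr⟩ := (Metric.isBounded_iff_subset_closedBall (0 : ℂ)).1 D.isBounded
  -- thresholds, shell by shell, for the aspect-`α` shells
  have hk : ∀ (x : ℂ) (ρ R : ℝ), ∃ k : ℕ, 0 < ρ → α * ρ ≤ R → R ≤ 1 →
      ∀ δ : ℝ, 0 < δ →
        SAW.law D.carrier δ (a δ) (b δ)
            {γ | (⟨γ.walk.toCurve (meshPoint δ)⟩ : Curve ℂ).HasTraversals k x ρ (α * ρ)}
          ≤ ENNReal.ofReal (α ^ 3 * (ρ / R) ^ (3 : ℝ)) := by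
    intro x ρ R
    by_cases hc : 0 < ρ ∧ α * ρ ≤ R ∧ R ≤ 1
    · obtain ⟨hρ, hαR, hR1⟩ := hc
      have hR : 0 < R := (mul_pos hα0 hρ).trans_le hαR
      have hε : 0 < ENNReal.ofReal (α ^ 3 * (ρ / R) ^ (3 : ℝ)) :=
        ENNReal.ofReal_pos.2 (mul_pos (pow_pos hα0 3) (Real.rpow_pos_of_pos (div_pos hρ hR) _))
      obtain ⟨k₁, hk₁⟩ := h D a b hab x ρ hρ (hαR.trans hR1) _ hε
      obtain ⟨δ₁, hδ₁, hsub⟩ := mem_nhdsGT_iff_exists_Ioo_subset.1 hk₁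
      set B : Finset (Site 2) :=
        Fintype.piFinset fun _ : Fin 2 => Finset.Icc (-⌈r / δ₁⌉) ⌈r / δ₁⌉ with hB
      set k₂ : ℕ := 2 * (B.card + 1) + 1 with hk₂
      refine ⟨max k₁ k₂, fun _ _ _ δ hδ => ?_⟩
      by_cases hsmall : δ < δ₁
      · -- eventual regime: the hypothesis at threshold `k₁`
        have h1 : SAW.law D.carrier δ (a δ) (b δ)
            {γ | (⟨γ.walk.toCurve (meshPoint δ)⟩ : Curve ℂ).HasTraversals k₁ x ρ (α * ρ)}
              ≤ ENNReal.ofReal (α ^ 3 * (ρ / R) ^ (3 : ℝ)) :=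
          hsub ⟨hδ, hsmall⟩
        exact le_trans (measure_mono fun γ hγ => hγ.of_le (le_max_left _ _)) h1
      · -- large mesh: the event is empty by the short-distance count
        have hδ₁δ : δ₁ ≤ δ := not_lt.1 hsmall
        have hρα : ρ < α * ρ := by nlinarith
        have hempty : {γ : SAW.DomainSAW D.carrier δ (a δ) (b δ) |
            (⟨γ.walk.toCurve (meshPoint δ)⟩ : Curve ℂ).HasTraversals (max k₁ k₂) x ρ (α * ρ)}
              = ∅ := by
          refine Set.eq_empty_of_forall_notMem fun γ hγ => ?_
          have hk₂' : (⟨γ.walk.toCurve (meshPoint δ)⟩ : Curve ℂ).HasTraversals k₂ x ρ (α * ρ) :=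
            hγ.of_le (le_max_right _ _)
          have hle := hasTraversals_toCurve_le (meshPoint δ) γ.walk hρα hk₂'
          have htail : γ.walk.support.tail.length ≤ B.card :=
            length_support_tail_le hr hδ₁ hδ₁δ γ.walk γ.isPath
          omega
        rw [hempty, measure_empty]
        exact bot_le
    · exact ⟨0, fun h1 h2 h3 => absurd ⟨h1, h2, h3⟩ hc⟩
  choose k hk using hk
  refine ⟨k, α ^ 3, 3, 1, by positivity, by norm_num, one_pos, ?_⟩
  intro δ hδ x ρ R hδρ hρR hR1
  have hρ : 0 < ρ := hδ.1.trans_le hδρ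
  have hR : 0 < R := hρ.trans hρR
  by_cases hwide : α * ρ ≤ R
  · -- wide shell: a traversal of `D(x; ρ, R)` is a traversal of `D(x; ρ, αρ)`
    refine le_trans (measure_mono fun γ hγ => ?_) (hk x ρ R hρ hwide hR1 δ hδ.1)
    exact hγ.mono' le_rfl hwide
  · -- thin shell: the bound exceeds the total mass `≤ 1`
    have hlt : R < α * ρ := not_le.1 hwide
    have hq : 1 ≤ α * (ρ / R) := by
      rw [← mul_div_assoc, one_le_div hR]
      exact hlt.le
    have h1 : (1 : ℝ) ≤ α ^ 3 * (ρ / R) ^ (3 : ℝ) := by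
      calc (1 : ℝ) ≤ (α * (ρ / R)) ^ (3 : ℝ) := Real.one_le_rpow hq (by norm_num)
        _ = α ^ (3 : ℝ) * (ρ / R) ^ (3 : ℝ) :=
            Real.mul_rpow hα0.le (div_nonneg hρ.le hR.le)
        _ = α ^ 3 * (ρ / R) ^ (3 : ℝ) := by
            rw [show (3 : ℝ) = ((3 : ℕ) : ℝ) by norm_num, Real.rpow_natCast]
    calc SAW.law D.carrier δ (a δ) (b δ)
          {γ | (⟨γ.walk.toCurve (meshPoint δ)⟩ : Curve ℂ).HasTraversals (k x ρ R) x ρ R}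
        ≤ 1 := SAW.law_apply_le_one _ _ _ _ _
      _ = ENNReal.ofReal 1 := ENNReal.ofReal_one.symm
      _ ≤ ENNReal.ofReal (α ^ 3 * (ρ / R) ^ (3 : ℝ)) := ENNReal.ofReal_le_ofReal h1

/-- **Converse: eventual tightness gives the count tightness of every aspect ratio.** From
`EventualTight` (stmt-1881), for every `α > 1`, every shell `D(x; ρ, αρ)` with `0 < ρ`, `αρ ≤ 1`
and every `ε > 0`, one threshold `k` works for all small meshes
(`shellCountTight_of_eventualTight`, restricted to meshes `δ < min δ₀ ρ`). [folklore] -/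
theorem aspectCountTight_of_eventualTight (hT : SAWTotalPositivity.EventualTight) {α : ℝ}
    (hα : 1 < α) :
    ∀ (D : DobrushinDomain) (a b : ℝ → Site 2), SAW.IsEndpointApprox D a b →
      ∀ (x : ℂ) (ρ : ℝ), 0 < ρ → α * ρ ≤ 1 → ∀ ε : ℝ≥0∞, 0 < ε →
        ∃ k : ℕ, ∀ᶠ δ in 𝓝[>] (0 : ℝ),
          SAW.law D.carrier δ (a δ) (b δ)
            {γ | (⟨γ.walk.toCurve (meshPoint δ)⟩ : Curve ℂ).HasTraversals k x ρ (α * ρ)} ≤ ε := by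
  intro D a b hab x ρ hρ hα1 ε hε
  have hT' : SAWLeftRightFKG.EventualTight := hT
  obtain ⟨δ₀, hδ₀, hsh⟩ := shellCountTight_of_eventualTight hT' D a b hab
  have hρα : ρ < α * ρ := by nlinarith
  obtain ⟨k, hk⟩ := hsh x ρ (α * ρ) hρ hρα hα1 ε hε
  refine ⟨k, ?_⟩
  have hmem : Set.Ioo (0 : ℝ) (min δ₀ ρ) ∈ 𝓝[>] (0 : ℝ) := Ioo_mem_nhdsGT (lt_min hδ₀ hρ)
  filter_upwards [hmem] with δ hδ
  exact hk δ ⟨hδ.1, hδ.2.le.trans (min_le_left _ _)⟩ (hδ.2.le.trans (min_le_right _ _))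

/-- **The exact open core of stmt-1880 (and of stmt-1881).** `SAWTraversalBound` holds if and only
if, for every Dobrushin domain and endpoint approximation, the number of separate traversals of each
ASPECT-2 shell `D(x; ρ, 2ρ)` (`0 < ρ ≤ 1/2`) by the mesh polyline of the critical SAW is eventually
tight as the mesh tends to `0`: `∀ ε > 0 ∃ k, P_δ(k traversals) ≤ ε` for all small `δ`. (`⇐`:
`sawTraversalBound_of_aspectCountTight`; `⇒`: the proved Aizenman–Burchard glue
`TraversalBoundTight_proof` and `aspectCountTight_of_eventualTight`.) This is uniform-in-mesh
precompactness information on the critical planar SAW at ONE pair of comparable scales — the open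
problem (Lawler–Schramm–Werner 2004, §3.4.2), with nothing else attached. [folklore] -/
theorem sawTraversalBound_iff_aspectTwoCountTight :
    SAWTotalPositivity.SAWTraversalBound ↔
      ∀ (D : DobrushinDomain) (a b : ℝ → Site 2), SAW.IsEndpointApprox D a b →
        ∀ (x : ℂ) (ρ : ℝ), 0 < ρ → 2 * ρ ≤ 1 → ∀ ε : ℝ≥0∞, 0 < ε →
          ∃ k : ℕ, ∀ᶠ δ in 𝓝[>] (0 : ℝ),
            SAW.law D.carrier δ (a δ) (b δ)
              {γ | (⟨γ.walk.toCurve (meshPoint δ)⟩ : Curve ℂ).HasTraversals k x ρ (2 * ρ)} ≤ ε :=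
  ⟨fun hS => aspectCountTight_of_eventualTight
      (sawTotalPositivity_sawTraversalBound_iff_eventualTight.1 hS) one_lt_two,
    fun h => sawTraversalBound_of_aspectCountTight one_lt_two h⟩

end Summit.CriticalPhenomena.SAWScalingLimit.Theorems

end

/-! ### Appendix (second landing): the lattice form of the open core

`aspectCountTight_of_latticeCrossingTight`, `sawTraversalBound_of_latticeCrossingTight`: eventual
tightness, for ONE aspect ratio `α > 1`, of the number of SEPARATED LATTICE CROSSINGS of
`D(x; ρ, αρ)` by the critical SAW (pairs of vertex indices of the walk whose mesh points lie on
opposite sides of the shell — the separated vertex traversals of `VertexShellTraversals.lean` for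
the list of mesh points of the walk) implies `SAWTraversalBound`, through the polyline/vertex
dictionary `vertexTraversals_of_hasTraversals_polyline` of `PolylineShellTraversals.lean` (lattice
edges have length `δ`, `Percolation.dist_meshPoint_of_adj`) and the extraction
`sepVertexTraversals_of_two_mul`. This is the statement a lattice argument (surgery, renewal,
correlation inequality) would actually prove; all real analysis (the `Path.trans` parametrisation
of the polyline, the Aizenman–Burchard exponent dress, mesh bookkeeping) is discharged. -/

noncomputable section

open MeasureTheory Filter Topology Set Metric
open Literature.Probability.RandomPlanarGeometry Literature.Probability.LatticeModels
open scoped ENNReal unitInterval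

namespace Summit.CriticalPhenomena.SAWScalingLimit.Theorems

open Summit.CriticalPhenomena.SAWScalingLimit.Theses

/-- Adjacent vertices of the discrete domain `Ω_δ` (`δ ≥ 0`) have mesh points at distance `≤ δ`
(in fact `= δ`: `Percolation.dist_meshPoint_of_adj`). [folklore] -/
theorem dist_meshPoint_le_of_discreteDomainGraph_adj {Ω : Set ℂ} {δ : ℝ} (hδ : 0 ≤ δ)
    {p q : Site 2} (h : (discreteDomainGraph Ω δ).Adj p q) :
    dist (meshPoint δ p) (meshPoint δ q) ≤ δ := by
  have hz : (zdGraph 2).Adj p q := meshGraph_le_zdGraph Ω δ (discreteDomainGraph_adj_iff.1 h).1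
  rw [Literature.Probability.Percolation.dist_meshPoint_of_adj hz, abs_of_nonneg hδ]

/-- The mesh points of a walk of `Ω_δ` (`δ ≥ 0`), in order, are pairwise `δ`-close along the list.
[folklore] -/
theorem isChain_dist_map_meshPoint_support {Ω : Set ℂ} {δ : ℝ} (hδ : 0 ≤ δ) {u v : Site 2}
    (w : (discreteDomainGraph Ω δ).Walk u v) :
    List.IsChain (fun p q : ℂ => dist p q ≤ δ) (w.support.map (meshPoint δ)) :=
  List.isChain_map_of_isChain (meshPoint δ)
    (fun _ _ hpq => dist_meshPoint_le_of_discreteDomainGraph_adj hδ hpq) w.isChain_adj_support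

/-- **`2k` separate traversals of a shell by the mesh polyline of a walk of `Ω_δ` give `k`
SEPARATED LATTICE CROSSINGS of any shell nested `δ`-inside it**: indices `ι m ≤ κ m` into the list
of mesh points, `κ m < ι m'` for `m < m'`, the two mesh points on opposite sides of `D(x; r', R')`
whenever `r + δ ≤ r' < R' ≤ R - δ`. (`vertexTraversals_of_hasTraversals_polyline`,
`vertexTraversals_mono`, `sepVertexTraversals_of_two_mul`.)
[cite: AizenmanBurchardDuke1999, §3.a (proof of Lemma 3.1)] -/
theorem sepLatticeCrossings_of_hasTraversals_toCurve {Ω : Set ℂ} {δ : ℝ} (hδ : 0 ≤ δ)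
    {u v : Site 2} (w : (discreteDomainGraph Ω δ).Walk u v) {k : ℕ} {x : ℂ} {r R r' R' : ℝ}
    (hr : r + δ ≤ r') (hR : R' ≤ R - δ) (hr'R' : r' < R')
    (h : (⟨w.toCurve (meshPoint δ)⟩ : Curve ℂ).HasTraversals (2 * k) x r R) :
    ∃ ι κ : Fin k → Fin (w.support.map (meshPoint δ)).length, (∀ m, ι m ≤ κ m) ∧
      (∀ m, (dist ((w.support.map (meshPoint δ)).get (ι m)) x ≤ r' ∧
          R' ≤ dist ((w.support.map (meshPoint δ)).get (κ m)) x) ∨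
        (R' ≤ dist ((w.support.map (meshPoint δ)).get (ι m)) x ∧
          dist ((w.support.map (meshPoint δ)).get (κ m)) x ≤ r')) ∧
      ∀ ⦃m m'⦄, m < m' → κ m < ι m' := by
  have hL : w.support.map (meshPoint δ) = meshPoint δ u :: w.support.tail.map (meshPoint δ) := by
    conv_lhs => rw [← w.cons_tail_support]
    rfl
  have hchain : List.IsChain (fun p q : ℂ => dist p q ≤ δ)
      (meshPoint δ u :: w.support.tail.map (meshPoint δ)) :=
    hL ▸ isChain_dist_map_meshPoint_support hδ w
  have h' : (⟨polyline (meshPoint δ u :: w.support.tail.map (meshPoint δ))⟩ : Curve ℂ).HasTraversals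
      (2 * k) x r R := by
    have hc : (⟨w.toCurve (meshPoint δ)⟩ : Curve ℂ) =
        ⟨polyline (meshPoint δ u :: w.support.tail.map (meshPoint δ))⟩ := by
      rw [SimpleGraph.Walk.toCurve, hL]
    rw [hc] at h
    exact h
  have hweak := vertexTraversals_of_hasTraversals_polyline hδ hchain h'
  rw [hL]
  exact sepVertexTraversals_of_two_mul (vertexTraversals_mono hweak hr hR) hr'R'

/-- **Lattice crossings control the polyline counts.** Let `α > 1`. Suppose that for every Dobrushin
domain, endpoint approximation, centre `x`, radius `ρ > 0` with `αρ ≤ 1` and `ε > 0` there is `k`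
such that, for all small meshes `δ`, with probability `≥ 1 - ε` the critical SAW does NOT contain
`k` separated lattice crossings of the shell `D(x; ρ, αρ)` (`k` pairs of vertex indices
`ι m ≤ κ m`, `κ m < ι m'` for `m < m'`, the two mesh points on opposite sides of the shell). Then the
traversal counts of the mesh POLYLINE are eventually tight on every shell of aspect ratio `α²`:
`2k` separate traversals of `D(x; ρ, α²ρ)` by the polyline give, at mesh
`δ < min((c-1)ρ, α(α-c)ρ)` with `c = (1+α)/2`, `k` separated lattice crossings of
`D(x; cρ, αcρ)` (`sepLatticeCrossings_of_hasTraversals_toCurve`). [folklore] -/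
theorem aspectCountTight_of_latticeCrossingTight {α : ℝ} (hα : 1 < α)
    (h : ∀ (D : DobrushinDomain) (a b : ℝ → Site 2), SAW.IsEndpointApprox D a b →
      ∀ (x : ℂ) (ρ : ℝ), 0 < ρ → α * ρ ≤ 1 → ∀ ε : ℝ≥0∞, 0 < ε →
        ∃ k : ℕ, ∀ᶠ δ in 𝓝[>] (0 : ℝ),
          SAW.law D.carrier δ (a δ) (b δ)
            {γ | ∃ ι κ : Fin k → Fin (γ.walk.support.map (meshPoint δ)).length, (∀ m, ι m ≤ κ m) ∧
              (∀ m, (dist ((γ.walk.support.map (meshPoint δ)).get (ι m)) x ≤ ρ ∧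
                  α * ρ ≤ dist ((γ.walk.support.map (meshPoint δ)).get (κ m)) x) ∨
                (α * ρ ≤ dist ((γ.walk.support.map (meshPoint δ)).get (ι m)) x ∧
                  dist ((γ.walk.support.map (meshPoint δ)).get (κ m)) x ≤ ρ)) ∧
              ∀ ⦃m m'⦄, m < m' → κ m < ι m'} ≤ ε) :
    ∀ (D : DobrushinDomain) (a b : ℝ → Site 2), SAW.IsEndpointApprox D a b →
      ∀ (x : ℂ) (ρ : ℝ), 0 < ρ → α ^ 2 * ρ ≤ 1 → ∀ ε : ℝ≥0∞, 0 < ε →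
        ∃ k : ℕ, ∀ᶠ δ in 𝓝[>] (0 : ℝ),
          SAW.law D.carrier δ (a δ) (b δ)
            {γ | (⟨γ.walk.toCurve (meshPoint δ)⟩ : Curve ℂ).HasTraversals k x ρ (α ^ 2 * ρ)} ≤ ε := by
  intro D a b hab x ρ hρ hρ1 ε hε
  have hα0 : 0 < α := one_pos.trans hα
  -- intermediate inner radius `c ρ`, `1 < c < α`
  set c : ℝ := (1 + α) / 2 with hc
  have hc1 : 1 < c := by rw [hc]; linarith
  have hcα : c < α := by rw [hc]; linarith
  have hρ' : 0 < c * ρ := mul_pos (by linarith) hρ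
  have hρ'1 : α * (c * ρ) ≤ 1 :=
    calc α * (c * ρ) ≤ α * (α * ρ) := by gcongr
      _ = α ^ 2 * ρ := by ring
      _ ≤ 1 := hρ1
  obtain ⟨k, hk⟩ := h D a b hab x (c * ρ) hρ' hρ'1 ε hε
  refine ⟨2 * k, ?_⟩
  -- margin for the mesh
  have hm1 : 0 < (c - 1) * ρ := mul_pos (by linarith) hρ
  have hm2 : 0 < α * (α - c) * ρ := mul_pos (mul_pos hα0 (by linarith)) hρ
  have hsmall : ∀ᶠ δ in 𝓝[>] (0 : ℝ), δ ∈ Set.Ioo 0 (min ((c - 1) * ρ) (α * (α - c) * ρ)) :=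
    Ioo_mem_nhdsGT (lt_min hm1 hm2)
  filter_upwards [hk, hsmall] with δ hkδ hδ
  refine le_trans (measure_mono fun γ hγ => ?_) hkδ
  simp only [Set.mem_setOf_eq] at hγ ⊢
  have hδ0 : 0 ≤ δ := hδ.1.le
  have hδ1 : δ ≤ (c - 1) * ρ := hδ.2.le.trans (min_le_left _ _)
  have hδ2 : δ ≤ α * (α - c) * ρ := hδ.2.le.trans (min_le_right _ _)
  have hin : ρ + δ ≤ c * ρ := by linarith [show (c - 1) * ρ = c * ρ - ρ by ring]
  have hout : α * (c * ρ) ≤ α ^ 2 * ρ - δ := by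
    linarith [show α * (α - c) * ρ = α ^ 2 * ρ - α * (c * ρ) by ring]
  have hlt : c * ρ < α * (c * ρ) := by
    have := mul_lt_mul_of_pos_right hα hρ'
    linarith
  exact sepLatticeCrossings_of_hasTraversals_toCurve hδ0 γ.walk hin hout hlt hγ

/-- **The lattice form of the open core of stmt-1880.** If, for some `α > 1`, for every Dobrushin
domain, endpoint approximation and shell `D(x; ρ, αρ)` (`0 < ρ`, `αρ ≤ 1`), the number of separated
lattice crossings of the shell by the critical SAW is eventually tight as the mesh tends to `0`
(`∀ ε ∃ k`, probability of `k` separated crossings `≤ ε` for all small `δ`), then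
`SAWTraversalBound` holds (`aspectCountTight_of_latticeCrossingTight` with aspect `α²`, then
`sawTraversalBound_of_aspectCountTight`). [folklore] -/
theorem sawTraversalBound_of_latticeCrossingTight {α : ℝ} (hα : 1 < α)
    (h : ∀ (D : DobrushinDomain) (a b : ℝ → Site 2), SAW.IsEndpointApprox D a b →
      ∀ (x : ℂ) (ρ : ℝ), 0 < ρ → α * ρ ≤ 1 → ∀ ε : ℝ≥0∞, 0 < ε →
        ∃ k : ℕ, ∀ᶠ δ in 𝓝[>] (0 : ℝ),
          SAW.law D.carrier δ (a δ) (b δ)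
            {γ | ∃ ι κ : Fin k → Fin (γ.walk.support.map (meshPoint δ)).length, (∀ m, ι m ≤ κ m) ∧
              (∀ m, (dist ((γ.walk.support.map (meshPoint δ)).get (ι m)) x ≤ ρ ∧
                  α * ρ ≤ dist ((γ.walk.support.map (meshPoint δ)).get (κ m)) x) ∨
                (α * ρ ≤ dist ((γ.walk.support.map (meshPoint δ)).get (ι m)) x ∧
                  dist ((γ.walk.support.map (meshPoint δ)).get (κ m)) x ≤ ρ)) ∧
              ∀ ⦃m m'⦄, m < m' → κ m < ι m'} ≤ ε) :
    SAWTotalPositivity.SAWTraversalBound :=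
  have hα2 : 1 < α ^ 2 := by nlinarith
  sawTraversalBound_of_aspectCountTight hα2 (aspectCountTight_of_latticeCrossingTight hα h)

/-- **Converse of the lattice form**: `EventualTight` (hence `SAWTraversalBound`) gives, for every
`α > 1`, eventual tightness of the number of separated lattice crossings of every shell
`D(x; ρ, αρ)`: `k` separated lattice crossings give `k` separate traversals of the same shell by
the polyline (`hasTraversals_polyline_of_sepVertexTraversals`), whose counts are eventually tight
(`aspectCountTight_of_eventualTight`). So the lattice form, too, is EQUIVALENT to the item.
[folklore] -/
theorem latticeCrossingTight_of_eventualTight (hT : SAWTotalPositivity.EventualTight) {α : ℝ}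
    (hα : 1 < α) :
    ∀ (D : DobrushinDomain) (a b : ℝ → Site 2), SAW.IsEndpointApprox D a b →
      ∀ (x : ℂ) (ρ : ℝ), 0 < ρ → α * ρ ≤ 1 → ∀ ε : ℝ≥0∞, 0 < ε →
        ∃ k : ℕ, ∀ᶠ δ in 𝓝[>] (0 : ℝ),
          SAW.law D.carrier δ (a δ) (b δ)
            {γ | ∃ ι κ : Fin k → Fin (γ.walk.support.map (meshPoint δ)).length, (∀ m, ι m ≤ κ m) ∧
              (∀ m, (dist ((γ.walk.support.map (meshPoint δ)).get (ι m)) x ≤ ρ ∧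
                  α * ρ ≤ dist ((γ.walk.support.map (meshPoint δ)).get (κ m)) x) ∨
                (α * ρ ≤ dist ((γ.walk.support.map (meshPoint δ)).get (ι m)) x ∧
                  dist ((γ.walk.support.map (meshPoint δ)).get (κ m)) x ≤ ρ)) ∧
              ∀ ⦃m m'⦄, m < m' → κ m < ι m'} ≤ ε := by
  intro D a b hab x ρ hρ hρ1 ε hε
  obtain ⟨k, hk⟩ := aspectCountTight_of_eventualTight hT hα D a b hab x ρ hρ hρ1 ε hε
  refine ⟨k, ?_⟩
  filter_upwards [hk] with δ hkδ
  refine le_trans (measure_mono fun γ hγ => ?_) hkδ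
  simp only [Set.mem_setOf_eq] at hγ ⊢
  have : (⟨γ.walk.toCurve (meshPoint δ)⟩ : Curve ℂ) =
      ⟨polyline (γ.walk.support.map (meshPoint δ))⟩ := rfl
  rw [this]
  exact hasTraversals_polyline_of_sepVertexTraversals hγ

end Summit.CriticalPhenomena.SAWScalingLimit.Theorems

end
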